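import Mathlib
import Literature.AlgebraicGeometry.Resolution.QuadraticTransforms
import HarnessLib

/-!
# Route `RadicialJung`, crux `CleanModels` (stmt-15917), stub `stub_cleanLU3Defect`, class (A) «arcs»: arc coordinates along the
# quadratic sequence and the kernel of reduction modulo `𝔪_v^N`

Line `Sketch` rev 18 of crux stmt-ResolutionOfSingularities-15917, memo `Cruxes/CleanModels/Lines/Sketch-memo-defect-residue.md` §3; lead
`res-B-lead-1` g2.  OURS; nothing here proves resolution in characteristic `p`.

Setting: `O` a valuation ring of `K` with a «uniformizing» value `v π` (every value `< 1` is `≤ v π`), `R ⊆ O` a local subring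
dominated by `O` whose maximal ideal is generated by `π, u, w` with `u, w` DEEP in `𝔪_O` (`v u, v w ≤ v π ^ M`) — ARC COORDINATES:
the valuation is, to order `M`, the `π`-adic valuation of the curve `u = w = 0`.

* `mem_span_of_valuation_le` — **kernel lemma**: for `N ≤ M`, every `y ∈ R` with `v y ≤ v π ^ N` lies in the ideal `(u, w, π^N)`
  (induction on `N`: `y = αu + βw + π^N γ` and `v γ < 1` forces `γ ∈ 𝔪_R = (π, u, w)`).  This is the algebraic substitute for the
  Taylor expansion of `h - c^p` along the arc.
* `maximalIdeal_quadraticTransform_arc` — **arc coordinates survive a quadratic transform**: if moreover `v u, v w ≤ v π ^ 2`, the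
  quadratic transform `R₁` of `R` along `O` contains `u/π, w/π` and `𝔪_{R₁} = (π, u/π, w/π)`.
-/

noncomputable section

set_option linter.dupNamespace false -- mandated namespace of this single-conjunct summit

open IsLocalRing
open Literature.AlgebraicGeometry.Resolution

namespace Summit.ResolutionOfSingularities.ResolutionOfSingularities.Theorems.RadicialJung.CleanModels

variable {K : Type} [Field K]

/-! ## The kernel of `R → O/𝔪_v^N` in arc coordinates -/

/-- Membership in the span of three elements. [folklore] -/
theorem mem_span_triple_iff {R : Type*} [CommRing R] (a b c y : R) :
    y ∈ Ideal.span ({a, b, c} : Set R) ↔ ∃ α β γ : R, y = α * a + β * b + γ * c := by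
  constructor
  · intro hy
    rw [Ideal.mem_span_insert] at hy
    obtain ⟨α, z, hz, rfl⟩ := hy
    rw [Ideal.mem_span_pair] at hz
    obtain ⟨β, γ, rfl⟩ := hz
    exact ⟨α, β, γ, by ring⟩
  · rintro ⟨α, β, γ, rfl⟩
    refine Ideal.add_mem _ (Ideal.add_mem _ ?_ ?_) ?_
    · exact Ideal.mul_mem_left _ _ (Ideal.subset_span (by simp))
    · exact Ideal.mul_mem_left _ _ (Ideal.subset_span (by simp))
    · exact Ideal.mul_mem_left _ _ (Ideal.subset_span (by simp))

/-- **Kernel lemma.** Let `R ⊆ O` be a local subring dominated by the valuation ring `O`, `π, u, w ∈ R` generating `𝔪_R` with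
`π ≠ 0`, and `v u, v w ≤ v π ^ M`.  Then for `N ≤ M` every `y ∈ R` with `v y ≤ v π ^ N` lies in the
ideal `(u, w, π ^ N)` of `R`. [folklore] -/
theorem mem_span_of_valuation_le {O : ValuationSubring K} {R : Subring K} [IsLocalRing R] (hdom : SubringDominates R O.toSubring)
    (π u w : R) (hm : maximalIdeal R = Ideal.span {π, u, w}) (hπ0 : (π : K) ≠ 0) {M : ℕ}
    (hu : O.valuation (u : K) ≤ O.valuation (π : K) ^ M) (hw : O.valuation (w : K) ≤ O.valuation (π : K) ^ M)
    {N : ℕ} (hN : N ≤ M) (y : R) (hy : O.valuation (y : K) ≤ O.valuation (π : K) ^ N) :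
    y ∈ Ideal.span {u, w, π ^ N} := by
  have hRO : R ≤ O.toSubring := hdom.1
  have hmem : ∀ a : R, a ∈ maximalIdeal R ↔ O.valuation (a : K) < 1 := (subringDominates_valuationSubring_iff hRO).mp hdom
  have hle1 : ∀ a : R, O.valuation (a : K) ≤ 1 := fun a => (O.valuation_le_one_iff _).mpr (hRO a.2)
  have hvπ1 : O.valuation (π : K) < 1 := (hmem π).mp (by rw [hm]; exact Ideal.subset_span (by simp))
  have hvπ0 : 0 < O.valuation (π : K) := zero_lt_iff.mpr ((Valuation.ne_zero_iff _).mpr hπ0)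
  have hanti : ∀ {a b : ℕ}, a ≤ b → O.valuation (π : K) ^ b ≤ O.valuation (π : K) ^ a := fun hab =>
    pow_le_pow_right_of_le_one' hvπ1.le hab
  induction N generalizing y with
  | zero =>
    rw [pow_zero]
    rw [mem_span_triple_iff]
    exact ⟨0, 0, y, by ring⟩
  | succ n ih =>
    -- first `y ∈ (u, w, π^n)`
    have hy' : O.valuation (y : K) ≤ O.valuation (π : K) ^ n := hy.trans (hanti (Nat.le_succ n))
    obtain ⟨α, β, γ, hyeq⟩ := (mem_span_triple_iff u w (π ^ n) y).mp (ih (Nat.le_of_succ_le hN) y hy')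
    -- the value of `π^n γ = y - α u - β w` is `≤ v π ^ (n+1)`
    have huM : O.valuation (u : K) ≤ O.valuation (π : K) ^ (n + 1) := hu.trans (hanti hN)
    have hwM : O.valuation (w : K) ≤ O.valuation (π : K) ^ (n + 1) := hw.trans (hanti hN)
    have hγ : O.valuation ((π : K) ^ n * (γ : K)) ≤ O.valuation (π : K) ^ (n + 1) := by
      have heq : (π : K) ^ n * (γ : K) = (y : K) - (α : K) * (u : K) - (β : K) * (w : K) := by
        have := congrArg (fun z : R => (z : K)) hyeq
        simp only [Subring.coe_add, Subring.coe_mul, Subring.coe_pow] at this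
        rw [this]; ring
      rw [heq]
      refine (Valuation.map_sub _ _ _).trans (max_le ((Valuation.map_sub _ _ _).trans (max_le hy ?_)) ?_)
      · rw [map_mul]
        calc O.valuation (α : K) * O.valuation (u : K) ≤ 1 * O.valuation (π : K) ^ (n + 1) := mul_le_mul' (hle1 α) huM
          _ = O.valuation (π : K) ^ (n + 1) := one_mul _
      · rw [map_mul]
        calc O.valuation (β : K) * O.valuation (w : K) ≤ 1 * O.valuation (π : K) ^ (n + 1) := mul_le_mul' (hle1 β) hwM
          _ = O.valuation (π : K) ^ (n + 1) := one_mul _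
    -- hence `v γ ≤ v π < 1`, `γ ∈ 𝔪_R = (π, u, w)`
    have hvγ : O.valuation (γ : K) < 1 := by
      rw [map_mul, map_pow, pow_succ] at hγ
      have h1 : O.valuation (γ : K) ≤ O.valuation (π : K) := le_of_mul_le_mul_left hγ (pow_pos hvπ0 n)
      exact lt_of_le_of_lt h1 hvπ1
    have hγm : γ ∈ Ideal.span {π, u, w} := by rw [← hm]; exact (hmem γ).mpr hvγ
    obtain ⟨α', β', γ', hγeq⟩ := (mem_span_triple_iff π u w γ).mp hγm
    rw [mem_span_triple_iff]
    refine ⟨α + π ^ n * β', β + π ^ n * γ', α', ?_⟩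
    rw [hyeq, hγeq]
    ring

/-! ## Arc coordinates survive a quadratic transform -/

/-- In `R[𝔪/π]` with `𝔪 = (π, u, w)`, every element is `r + (u/π)·a + (w/π)·b` with `r ∈ R` and `a, b ∈ R[𝔪/π]`. [folklore] -/
theorem exists_decomp_blowupRing {R : Subring K} [IsLocalRing R] (π u w : R) (hm : maximalIdeal R = Ideal.span {π, u, w})
    (hπ0 : (π : K) ≠ 0) (y : K) (hy : y ∈ blowupRing R (π : K)) :
    ∃ r : R, ∃ a b : K, a ∈ blowupRing R (π : K) ∧ b ∈ blowupRing R (π : K) ∧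
      y = (r : K) + (u : K) / (π : K) * a + (w : K) / (π : K) * b := by
  have hgen : blowupRing R (π : K) = Subring.closure ((R : Set K) ∪ (fun z : R => (z : K) / (π : K)) '' ({π, u, w} : Set R)) :=
    blowupRing_eq_closure_of_span_eq (π : K) {π, u, w} hm.symm
  have hRB : ∀ r : R, (r : K) ∈ blowupRing R (π : K) := fun r => le_blowupRing R (π : K) r.2
  have hcl : ∀ z : K, z ∈ Subring.closure ((R : Set K) ∪ (fun z : R => (z : K) / (π : K)) '' ({π, u, w} : Set R)) →
      z ∈ blowupRing R (π : K) := fun z hz => by rw [hgen]; exact hz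
  rw [hgen] at hy
  induction hy using Subring.closure_induction with
  | mem z hz =>
    rcases hz with hz | ⟨t, ht, rfl⟩
    · exact ⟨⟨z, hz⟩, 0, 0, Subring.zero_mem _, Subring.zero_mem _, by simp⟩
    · simp only [Set.mem_insert_iff, Set.mem_singleton_iff] at ht
      rcases ht with ht | ht | ht
      · refine ⟨1, 0, 0, Subring.zero_mem _, Subring.zero_mem _, ?_⟩
        rw [ht]; simp [div_self hπ0]
      · refine ⟨0, 1, 0, Subring.one_mem _, Subring.zero_mem _, ?_⟩
        rw [ht]; simp
      · refine ⟨0, 0, 1, Subring.zero_mem _, Subring.one_mem _, ?_⟩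
        rw [ht]; simp
  | zero => exact ⟨0, 0, 0, Subring.zero_mem _, Subring.zero_mem _, by simp⟩
  | one => exact ⟨1, 0, 0, Subring.zero_mem _, Subring.zero_mem _, by simp⟩
  | add y z _ _ hy hz =>
    obtain ⟨r, a, b, ha, hb, rfl⟩ := hy
    obtain ⟨r', a', b', ha', hb', rfl⟩ := hz
    exact ⟨r + r', a + a', b + b', Subring.add_mem _ ha ha', Subring.add_mem _ hb hb', by push_cast; ring⟩
  | neg y _ hy =>
    obtain ⟨r, a, b, ha, hb, rfl⟩ := hy
    exact ⟨-r, -a, -b, Subring.neg_mem _ ha, Subring.neg_mem _ hb, by push_cast; ring⟩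
  | mul y z _ hz' hy hz =>
    obtain ⟨r, a, b, ha, hb, rfl⟩ := hy
    obtain ⟨r', a', b', ha', hb', rfl⟩ := hz
    have hz'' := hcl _ hz'
    refine ⟨r * r', a * ((r' : K) + (u : K) / (π : K) * a' + (w : K) / (π : K) * b') + (r : K) * a',
      b * ((r' : K) + (u : K) / (π : K) * a' + (w : K) / (π : K) * b') + (r : K) * b', ?_, ?_, ?_⟩
    · exact Subring.add_mem _ (Subring.mul_mem _ ha hz'') (Subring.mul_mem _ (hRB r) ha')
    · exact Subring.add_mem _ (Subring.mul_mem _ hb hz'') (Subring.mul_mem _ (hRB r) hb')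
    · push_cast; ring

/-- **Arc coordinates survive a quadratic transform.** Let `R ⊆ O` be local, dominated by the valuation ring `O`, with
`𝔪_R = (π, u, w)`, `π ≠ 0` of maximal value in `𝔪_R` (every value `< 1` is `≤ v π`) and `v u, v w ≤ v π ^ 2`.  If `R₁` is the quadratic
transform of `R` along `O`, then `u/π, w/π ∈ R₁` and `𝔪_{R₁} = (π, u/π, w/π)`. [folklore] -/
theorem maximalIdeal_quadraticTransform_arc {O : ValuationSubring K} {R R₁ : Subring K} [IsLocalRing R]
    (h : IsQuadraticTransformAlong O R R₁) (hdom : SubringDominates R O.toSubring) (π u w : ↥R)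
    (hm : maximalIdeal R = Ideal.span {π, u, w}) (hπ0 : (π : K) ≠ 0)
    (hπ : ∀ x : K, O.valuation x < 1 → O.valuation x ≤ O.valuation (π : K))
    (hu : O.valuation (u : K) ≤ O.valuation (π : K) ^ 2) (hw : O.valuation (w : K) ≤ O.valuation (π : K) ^ 2) :
    ∃ (hu₁ : (u : K) / (π : K) ∈ R₁) (hw₁ : (w : K) / (π : K) ∈ R₁) (hπ₁ : (π : K) ∈ R₁),
      (haveI := h.isLocalRing; maximalIdeal R₁) =
        Ideal.span {(⟨(π : K), hπ₁⟩ : R₁), ⟨(u : K) / (π : K), hu₁⟩, ⟨(w : K) / (π : K), hw₁⟩} := by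
  classical
  have hRO : R ≤ O.toSubring := hdom.1
  have hmem : ∀ a : R, a ∈ maximalIdeal R ↔ O.valuation (a : K) < 1 := (subringDominates_valuationSubring_iff hRO).mp hdom
  have hle1 : ∀ a : K, a ∈ O → O.valuation a ≤ 1 := fun a ha => (O.valuation_le_one_iff _).mpr ha
  have hπm : π ∈ maximalIdeal R := by rw [hm]; exact Ideal.subset_span (by simp)
  have hum : u ∈ maximalIdeal R := by rw [hm]; exact Ideal.subset_span (by simp)
  have hwm : w ∈ maximalIdeal R := by rw [hm]; exact Ideal.subset_span (by simp)
  have hvπ : O.valuation (π : K) < 1 := (hmem π).mp hπm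
  have hvπpos : 0 < O.valuation (π : K) := zero_lt_iff.mpr ((Valuation.ne_zero_iff _).mpr hπ0)
  have hsq : O.valuation (π : K) ^ 2 ≤ O.valuation (π : K) := by
    rw [pow_two]; exact mul_le_of_le_one_left zero_le hvπ.le
  have hvu : O.valuation (u : K) ≤ O.valuation (π : K) := hu.trans hsq
  have hvw : O.valuation (w : K) ≤ O.valuation (π : K) := hw.trans hsq
  -- the transform along `O`, presented with `u₀ = π`
  have hQT : IsQuadraticTransformAlong O R (locAtCentre (blowupRing R (π : K)) O) := by
    refine ⟨‹_›, hRO, {π, u, w}, π, ?_, by simp, fun h0 => hπ0 (by rw [h0]; rfl), ?_, ?_⟩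
    · rw [hm, Finset.coe_insert, Finset.coe_insert, Finset.coe_singleton]
    · intro x hx
      simp only [Finset.mem_insert, Finset.mem_singleton] at hx
      rcases hx with rfl | rfl | rfl
      · exact le_rfl
      · exact hvu
      · exact hvw
    · rw [blowupRing_eq_closure_of_span_eq (π : K) (↑({π, u, w} : Finset R) : Set R)
        (by rw [hm, Finset.coe_insert, Finset.coe_insert, Finset.coe_singleton])]
  have hR₁ : R₁ = locAtCentre (blowupRing R (π : K)) O := h.unique hQT
  have hdom₁ : SubringDominates R₁ O.toSubring := h.dominated
  have hB : blowupRing R (π : K) ≤ R₁ := by rw [hR₁]; exact le_locAtCentre _ _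
  have hu₁ : (u : K) / (π : K) ∈ R₁ := hB (div_mem_blowupRing (π : K) hum)
  have hw₁ : (w : K) / (π : K) ∈ R₁ := hB (div_mem_blowupRing (π : K) hwm)
  have hπ₁ : (π : K) ∈ R₁ := h.le π.2
  refine ⟨hu₁, hw₁, hπ₁, ?_⟩
  haveI := h.isLocalRing
  have hmem₁ : ∀ a : R₁, a ∈ maximalIdeal R₁ ↔ O.valuation (a : K) < 1 :=
    (subringDominates_valuationSubring_iff hdom₁.1).mp hdom₁
  have hvuπ : O.valuation ((u : K) / (π : K)) < 1 := by
    rw [map_div₀, div_lt_one₀ hvπpos]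
    refine lt_of_le_of_lt hu ?_
    rw [pow_two]; exact mul_lt_of_lt_one_left hvπpos hvπ
  have hvwπ : O.valuation ((w : K) / (π : K)) < 1 := by
    rw [map_div₀, div_lt_one₀ hvπpos]
    refine lt_of_le_of_lt hw ?_
    rw [pow_two]; exact mul_lt_of_lt_one_left hvπpos hvπ
  apply le_antisymm
  · intro q hq
    have hvq : O.valuation (q : K) < 1 := (hmem₁ q).mp hq
    have hq' : (q : K) ∈ locAtCentre (blowupRing R (π : K)) O := by rw [← hR₁]; exact q.2
    obtain ⟨y, hy, z, hz, hvz, hqeq⟩ := hq'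
    obtain ⟨r, a, b, ha, hb, hyeq⟩ := exists_decomp_blowupRing π u w hm hπ0 y hy
    have hz0 : z ≠ 0 := ne_zero_of_valuation_eq_one hvz
    have haO : a ∈ O := hdom₁.1 (hB ha)
    have hbO : b ∈ O := hdom₁.1 (hB hb)
    -- `v r < 1`
    have hvy : O.valuation y < 1 := by
      have : y = (q : K) * z := by rw [hqeq, div_mul_cancel₀ _ hz0]
      rw [this, map_mul, hvz, mul_one]; exact hvq
    have hvr : O.valuation (r : K) < 1 := by
      have hreq : (r : K) = y - ((u : K) / (π : K) * a + (w : K) / (π : K) * b) := by rw [hyeq]; ring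
      rw [hreq]
      refine lt_of_le_of_lt (Valuation.map_sub _ _ _) (max_lt hvy (lt_of_le_of_lt (Valuation.map_add _ _ _) (max_lt ?_ ?_)))
      · rw [map_mul]; exact mul_lt_one_of_nonneg_of_lt_one_left zero_le hvuπ (hle1 a haO)
      · rw [map_mul]; exact mul_lt_one_of_nonneg_of_lt_one_left zero_le hvwπ (hle1 b hbO)
    have hrm : r ∈ Ideal.span {π, u, w} := by rw [← hm]; exact (hmem r).mpr hvr
    obtain ⟨α, β, γ, hreq'⟩ := (mem_span_triple_iff π u w r).mp hrm
    -- `z⁻¹ ∈ R₁`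
    have hzinvO : z⁻¹ ∈ O := by rw [← O.valuation_le_one_iff, map_inv₀, hvz, inv_one]
    have hzinv : z⁻¹ ∈ R₁ := hdom₁.2 z (hB hz) hzinvO
    -- assemble
    rw [mem_span_triple_iff]
    refine ⟨⟨z⁻¹ * (α : K), R₁.mul_mem hzinv (h.le α.2)⟩,
      ⟨z⁻¹ * ((β : K) * (π : K) + a), R₁.mul_mem hzinv (R₁.add_mem (R₁.mul_mem (h.le β.2) hπ₁) (hB ha))⟩,
      ⟨z⁻¹ * ((γ : K) * (π : K) + b), R₁.mul_mem hzinv (R₁.add_mem (R₁.mul_mem (h.le γ.2) hπ₁) (hB hb))⟩, Subtype.ext ?_⟩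
    change (q : K) = z⁻¹ * (α : K) * (π : K) + z⁻¹ * ((β : K) * (π : K) + a) * ((u : K) / (π : K)) +
      z⁻¹ * ((γ : K) * (π : K) + b) * ((w : K) / (π : K))
    have hr' : (r : K) = (α : K) * (π : K) + (β : K) * (u : K) + (γ : K) * (w : K) := by
      have := congrArg (fun t : R => (t : K)) hreq'
      simpa using this
    rw [hqeq, hyeq, hr']
    field_simp
    ring
  · rw [Ideal.span_le]
    intro t ht
    simp only [Set.mem_insert_iff, Set.mem_singleton_iff] at ht
    rcases ht with rfl | rfl | rfl
    · exact (hmem₁ _).mpr hvπ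
    · exact (hmem₁ _).mpr hvuπ
    · exact (hmem₁ _).mpr hvwπ

end Summit.ResolutionOfSingularities.ResolutionOfSingularities.Theorems.RadicialJung.CleanModels

end
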